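import Mathlib
import HarnessLib
import Summits.Ventures.LatticeQCDFlow.Exactness.NCMCGeneralSpaceIndicatorCLT
import Summits.Ventures.LatticeQCDFlow.Exactness.NCMCGeneralSpaceOccupancyChainDoeblinHeatBath

/-!
# CLT-width error bars for the NCMC lane: from EVERY initial state, `√n (p̂_n − σ(c − ΔF)) ⇒ N(0, 2τ_int σ(1−σ))` and `√n (dF_occ,n − ΔF) ⇒ N(0, 2τ_int/(σ(1−σ)))`

HONEST FRAMING: exact (Metropolis-corrected) sampling algorithms for lattice gauge theory;
figures of merit are autocorrelation/cost numbers at stated couplings and volumes; no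
continuum-physics claim.

Venture `LatticeQCDFlow` (cell pub-lqcd), topic `Exactness`; FANOUT row 13 (`eng-snf`, GEN-19).
NEW WORK of the cell, not a published result; no definition is introduced; nothing is cited as a
fact.  ASSEMBLY: GEN-19's event-frequency / logit CLT under a Doeblin power
(`NCMCGeneralSpaceIndicatorCLT`) applied to the iteration kernel
`Q = switchKernel κF κR c W s e ∘ₖ levelKernel T₀ T₁` of the engine's NCMC lane (`latflow-snf`,
`correction = ncmc-metropolis`, `run_ncmc_chain`) with GEN-18's TWO-STEP Doeblin certificate
(`NCMCGeneralSpaceOccupancyChainDoeblin` / `…Mirror`: `ε • ν ≤ (nHit Q 2)(z, ·)` for every `z`, for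
every `c ≠ ΔF` unconditionally) and GEN-17's occupancy law `π_c(target) = σ(c − ΔF)`
(`NCMCGeneralSpaceOccupancyChain`).  GEN-18 gave the Chebyshev-type deviation bound for `dF_occ`
("the Doeblin constant gives only Chebyshev now"); this file gives the GAUSSIAN limit: the reported
`dF_occ ± z √(2 τ_int / (n p̂(1 − p̂)))` is an asymptotically exact `N(0,1)([−z, z])` interval, with
`τ_int = Scoring.tauInt (setACF Q π_c target)` the integrated autocorrelation time of the occupancy
indicator (bounded by `1/2 + (2/ε − 1)/(1 − σ)`, GEN-18 `CrooksPair.ncmc_tauInt_occupancy_le_of_sq`).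

## Content (Crooks pair `(κF, κR, s, e, W)` from `ν₀` to `ν₁` (finite, non-zero), level samplers
## `T₀`, `T₁` leaving `ν₀`, `ν₁` invariant, `e^{−ΔF} = Z₁/Z₀`, `σ = σ(c − ΔF)`,
## `π_c = (Π_c Ω)⁻¹ Π_c`, `ρ_occ = setACF Q π_c (target level)`, `p̂_n` the occupancy fraction,
## `dF_occ,n = c − log(p̂_n/(1 − p̂_n))`; `z` ANY initial state of the expanded ensemble)

* **`CrooksPair.ncmc_occupancy_clt_of_sq`** — under a two-step minorisation `ε • ν ≤ nHit Q 2 z`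
  (`ε ≠ 0`): for every `Y ~ N(0, 2 τ_int(ρ_occ) σ(1 − σ))`,
  `TendstoInDistribution (fun n x => √n (p̂_n(x) − σ)) atTop Y (fun _ => P_{δ_z}) P'`.
* **`CrooksPair.ncmc_dFocc_clt_of_sq`** — for every `Y ~ N(0, 2 τ_int(ρ_occ) / (σ(1 − σ)))`,
  `TendstoInDistribution (fun n x => √n (dF_occ,n(x) − ΔF)) atTop Y (fun _ => P_{δ_z}) P'`.
* **`CrooksPair.ncmc_occupancy_clt_of_exists_sq`**, **`CrooksPair.ncmc_dFocc_clt_of_exists_sq`** —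
  the same from an existential certificate (`NCMCGeneralSpaceOccupancyChainDoeblinMirror`:
  `CrooksPair.ncmc_exists_sq_doeblin_of_ne` supplies it for EVERY `c ≠ ΔF` when `ν_i ≪ m_i ≤ T_i`).

(The instance binder `[IsProbabilityMeasure P_{δ_z}]` is `inferInstance` at call sites, as in row 8's
`Scoring/MarkovChainCLT.lean`.)  NOT CLAIMED: a consistent estimator of `τ_int(ρ_occ)`
(studentisation by a windowed / batch-means estimate is not typed); rates; the degenerate protocol
`W ≡ c = ΔF` (no Doeblin power); anything numerical.
-/

namespace Summit.Ventures.LatticeQCDFlow.Exactness.GeneralNCMC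

open MeasureTheory ProbabilityTheory Set Filter Finset
open scoped ENNReal Topology

section NCMC

variable {Ω E : Type*} [MeasurableSpace Ω] [MeasurableSpace E]
  {ν₀ ν₁ : Measure Ω} [IsFiniteMeasure ν₀] [IsFiniteMeasure ν₁]
  {κF κR : Kernel Ω E} [IsMarkovKernel κF] [IsMarkovKernel κR] {s e : E → Ω} {W : E → ℝ} {c : ℝ}
  {T₀ T₁ : Kernel Ω Ω} [IsMarkovKernel T₀] [IsMarkovKernel T₁] {ε : ℝ≥0∞}
  {ν : Measure (Bool × Ω)} [IsProbabilityMeasure ν]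
  {Ω' : Type*} [MeasurableSpace Ω'] {P' : Measure Ω'} [IsProbabilityMeasure P'] {Y : Ω' → ℝ}

/-- **THE OCCUPANCY CLT FROM EVERY INITIAL STATE.**  Under a two-step minorisation
`ε • ν ≤ (nHit Q 2)(z, ·)` (`ε ≠ 0`) of the NCMC iteration kernel: for every initial state `z` of the
expanded ensemble and every real random variable `Y` with law `N(0, 2 τ_int(ρ_occ) σ(1 − σ))`
(`σ = σ(c − ΔF)`), `√n (p̂_n − σ)` converges in distribution to `Y` under `P_{δ_z}`. -/
theorem CrooksPair.ncmc_occupancy_clt_of_sq (h : CrooksPair ν₀ ν₁ κF κR s e W)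
    (h0 : ν₀ univ ≠ 0) (h1 : ν₁ univ ≠ 0) (hT₀ : Kernel.Invariant T₀ ν₀)
    (hT₁ : Kernel.Invariant T₁ ν₁) (hε : ε ≠ 0)
    (hD : haveI := isMarkovKernel_switchKernel (κF := κF) (κR := κR) (c := c)
              h.measurable_W h.measurable_s h.measurable_e
      ∀ z, ε • ν ≤ nHit (switchKernel κF κR c W s e ∘ₖ levelKernel T₀ T₁) 2 z)
    {ΔF : ℝ} (hΔF : Real.exp (-ΔF) = ((ν₀ univ)⁻¹ * ν₁ univ).toReal) (z : Bool × Ω)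
    (hY : haveI := isMarkovKernel_switchKernel (κF := κF) (κR := κR) (c := c)
              h.measurable_W h.measurable_s h.measurable_e
      HasLaw Y (gaussianReal 0 (Real.toNNReal
        (2 * Scoring.tauInt (setACF (switchKernel κF κR c W s e ∘ₖ levelKernel T₀ T₁)
            ((jointWeight c ν₀ ν₁ univ)⁻¹ • jointWeight c ν₀ ν₁) (targetLevel Ω))
          * (Real.sigmoid (c - ΔF) * (1 - Real.sigmoid (c - ΔF)))))) P')
    [hP : haveI := isMarkovKernel_switchKernel (κF := κF) (κR := κR) (c := c)
              h.measurable_W h.measurable_s h.measurable_e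
      haveI := isMarkovKernel_levelKernel T₀ T₁
      IsProbabilityMeasure (Kernel.trajMeasure (X := fun _ : ℕ => Bool × Ω) (Measure.dirac z)
        (fun n : ℕ => (switchKernel κF κR c W s e ∘ₖ levelKernel T₀ T₁).comap
          (fun hh : (j : ↥(Finset.Iic n)) → Bool × Ω => hh ⟨n, Finset.mem_Iic.2 le_rfl⟩)
          (measurable_pi_apply _)))] :
    haveI := isMarkovKernel_switchKernel (κF := κF) (κR := κR) (c := c)
      h.measurable_W h.measurable_s h.measurable_e
    haveI := isMarkovKernel_levelKernel T₀ T₁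
    TendstoInDistribution (fun (n : ℕ) (x : ℕ → Bool × Ω) =>
        Real.sqrt n * ((∑ i ∈ range n, (targetLevel Ω).indicator (1 : Bool × Ω → ℝ) (x i)) / n
          - Real.sigmoid (c - ΔF)))
      atTop Y (fun _ => Kernel.trajMeasure (X := fun _ : ℕ => Bool × Ω) (Measure.dirac z)
        (fun n : ℕ => (switchKernel κF κR c W s e ∘ₖ levelKernel T₀ T₁).comap
          (fun hh : (j : ↥(Finset.Iic n)) → Bool × Ω => hh ⟨n, Finset.mem_Iic.2 le_rfl⟩)
          (measurable_pi_apply _))) P' := by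
  haveI := isMarkovKernel_switchKernel (κF := κF) (κR := κR) (c := c)
    h.measurable_W h.measurable_s h.measurable_e
  haveI := isMarkovKernel_levelKernel T₀ T₁
  haveI := isProbabilityMeasure_jointLaw c ν₀ ν₁ h0
  have hπ : Kernel.Invariant (switchKernel κF κR c W s e ∘ₖ levelKernel T₀ T₁)
      ((jointWeight c ν₀ ν₁ univ)⁻¹ • jointWeight c ν₀ ν₁) :=
    invariant_smul _ (iteration_invariant h hT₀ hT₁ c) _
  have hσ := jointLaw_real_targetLevel c ν₀ ν₁ h0 h1 hΔF
  have hp0 : 0 < ((jointWeight c ν₀ ν₁ univ)⁻¹ • jointWeight c ν₀ ν₁).real (targetLevel Ω) := by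
    rw [hσ]; exact Real.sigmoid_pos _
  have hp1 : ((jointWeight c ν₀ ν₁ univ)⁻¹ • jointWeight c ν₀ ν₁).real (targetLevel Ω) < 1 := by
    rw [hσ]; exact Real.sigmoid_lt_one _
  rw [← hσ] at hY ⊢
  exact tendstoInDistribution_indicator_timeAverage_of_nHit hπ hε hD (by norm_num)
    measurableSet_targetLevel hp0 hp1 (Measure.dirac z) hY

/-- **THE `dF_occ` CLT FROM EVERY INITIAL STATE** (delta method at the logit): for every initial
state `z` and every `Y` with law `N(0, 2 τ_int(ρ_occ) / (σ(1 − σ)))`,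
`√n (dF_occ,n − ΔF) = √n ((c − log(p̂_n/(1 − p̂_n))) − ΔF)` converges in distribution to `Y` under
`P_{δ_z}`. -/
theorem CrooksPair.ncmc_dFocc_clt_of_sq (h : CrooksPair ν₀ ν₁ κF κR s e W)
    (h0 : ν₀ univ ≠ 0) (h1 : ν₁ univ ≠ 0) (hT₀ : Kernel.Invariant T₀ ν₀)
    (hT₁ : Kernel.Invariant T₁ ν₁) (hε : ε ≠ 0)
    (hD : haveI := isMarkovKernel_switchKernel (κF := κF) (κR := κR) (c := c)
              h.measurable_W h.measurable_s h.measurable_e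
      ∀ z, ε • ν ≤ nHit (switchKernel κF κR c W s e ∘ₖ levelKernel T₀ T₁) 2 z)
    {ΔF : ℝ} (hΔF : Real.exp (-ΔF) = ((ν₀ univ)⁻¹ * ν₁ univ).toReal) (z : Bool × Ω)
    (hY : haveI := isMarkovKernel_switchKernel (κF := κF) (κR := κR) (c := c)
              h.measurable_W h.measurable_s h.measurable_e
      HasLaw Y (gaussianReal 0 (Real.toNNReal
        (2 * Scoring.tauInt (setACF (switchKernel κF κR c W s e ∘ₖ levelKernel T₀ T₁)
            ((jointWeight c ν₀ ν₁ univ)⁻¹ • jointWeight c ν₀ ν₁) (targetLevel Ω))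
          / (Real.sigmoid (c - ΔF) * (1 - Real.sigmoid (c - ΔF)))))) P')
    [hP : haveI := isMarkovKernel_switchKernel (κF := κF) (κR := κR) (c := c)
              h.measurable_W h.measurable_s h.measurable_e
      haveI := isMarkovKernel_levelKernel T₀ T₁
      IsProbabilityMeasure (Kernel.trajMeasure (X := fun _ : ℕ => Bool × Ω) (Measure.dirac z)
        (fun n : ℕ => (switchKernel κF κR c W s e ∘ₖ levelKernel T₀ T₁).comap
          (fun hh : (j : ↥(Finset.Iic n)) → Bool × Ω => hh ⟨n, Finset.mem_Iic.2 le_rfl⟩)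
          (measurable_pi_apply _)))] :
    haveI := isMarkovKernel_switchKernel (κF := κF) (κR := κR) (c := c)
      h.measurable_W h.measurable_s h.measurable_e
    haveI := isMarkovKernel_levelKernel T₀ T₁
    TendstoInDistribution (fun (n : ℕ) (x : ℕ → Bool × Ω) =>
        Real.sqrt n * ((c - Real.log
            ((∑ i ∈ range n, (targetLevel Ω).indicator (1 : Bool × Ω → ℝ) (x i)) / n /
              (1 - (∑ i ∈ range n, (targetLevel Ω).indicator (1 : Bool × Ω → ℝ) (x i)) / n)))
          - ΔF))
      atTop Y (fun _ => Kernel.trajMeasure (X := fun _ : ℕ => Bool × Ω) (Measure.dirac z)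
        (fun n : ℕ => (switchKernel κF κR c W s e ∘ₖ levelKernel T₀ T₁).comap
          (fun hh : (j : ↥(Finset.Iic n)) → Bool × Ω => hh ⟨n, Finset.mem_Iic.2 le_rfl⟩)
          (measurable_pi_apply _))) P' := by
  haveI := isMarkovKernel_switchKernel (κF := κF) (κR := κR) (c := c)
    h.measurable_W h.measurable_s h.measurable_e
  haveI := isMarkovKernel_levelKernel T₀ T₁
  haveI := isProbabilityMeasure_jointLaw c ν₀ ν₁ h0
  have hπ : Kernel.Invariant (switchKernel κF κR c W s e ∘ₖ levelKernel T₀ T₁)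
      ((jointWeight c ν₀ ν₁ univ)⁻¹ • jointWeight c ν₀ ν₁) :=
    invariant_smul _ (iteration_invariant h hT₀ hT₁ c) _
  have hσ := jointLaw_real_targetLevel c ν₀ ν₁ h0 h1 hΔF
  have hp0 : 0 < ((jointWeight c ν₀ ν₁ univ)⁻¹ • jointWeight c ν₀ ν₁).real (targetLevel Ω) := by
    rw [hσ]; exact Real.sigmoid_pos _
  have hp1 : ((jointWeight c ν₀ ν₁ univ)⁻¹ • jointWeight c ν₀ ν₁).real (targetLevel Ω) < 1 := by
    rw [hσ]; exact Real.sigmoid_lt_one _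
  -- the logit CLT for `−Y`, then negate
  have hnY : HasLaw (fun ω => -Y ω) (gaussianReal 0 (Real.toNNReal
      (2 * Scoring.tauInt (setACF (switchKernel κF κR c W s e ∘ₖ levelKernel T₀ T₁)
          ((jointWeight c ν₀ ν₁ univ)⁻¹ • jointWeight c ν₀ ν₁) (targetLevel Ω))
        / (((jointWeight c ν₀ ν₁ univ)⁻¹ • jointWeight c ν₀ ν₁).real (targetLevel Ω)
          * (1 - ((jointWeight c ν₀ ν₁ univ)⁻¹ • jointWeight c ν₀ ν₁).real (targetLevel Ω)))))) P' := by
    have hneg := gaussianReal_neg hY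
    rw [neg_zero] at hneg
    rw [hσ]
    exact hneg
  have hlogit := tendstoInDistribution_logit_timeAverage_of_nHit hπ hε hD (by norm_num)
    measurableSet_targetLevel hp0 hp1 (Measure.dirac z) hnY
  have hcomp := hlogit.continuous_comp (g := fun r : ℝ => -r) continuous_neg
  have hlimfun : ((fun r : ℝ => -r) ∘ fun ω => -Y ω) = Y := by
    funext ω
    simp
  rw [hlimfun] at hcomp
  have hfun : (fun (n : ℕ) (x : ℕ → Bool × Ω) =>
      Real.sqrt n * ((c - Real.log
          ((∑ i ∈ range n, (targetLevel Ω).indicator (1 : Bool × Ω → ℝ) (x i)) / n /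
            (1 - (∑ i ∈ range n, (targetLevel Ω).indicator (1 : Bool × Ω → ℝ) (x i)) / n)))
        - ΔF))
      = fun (n : ℕ) => (fun r : ℝ => -r) ∘ fun (x : ℕ → Bool × Ω) =>
        Real.sqrt n * (Real.log
            (((∑ t ∈ range n, (targetLevel Ω).indicator (1 : Bool × Ω → ℝ) (x t)) / n)
              / (1 - (∑ t ∈ range n, (targetLevel Ω).indicator (1 : Bool × Ω → ℝ) (x t)) / n))
          - Real.log (((jointWeight c ν₀ ν₁ univ)⁻¹ • jointWeight c ν₀ ν₁).real (targetLevel Ω)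
            / (1 - ((jointWeight c ν₀ ν₁ univ)⁻¹ • jointWeight c ν₀ ν₁).real (targetLevel Ω)))) := by
    funext n x
    simp only [Function.comp_apply]
    rw [hσ, log_sigmoid_div]
    ring
  rw [hfun]
  exact hcomp

/-- **From an existential two-step certificate: the occupancy CLT from every initial state.** -/
theorem CrooksPair.ncmc_occupancy_clt_of_exists_sq (h : CrooksPair ν₀ ν₁ κF κR s e W)
    (h0 : ν₀ univ ≠ 0) (h1 : ν₁ univ ≠ 0) (hT₀ : Kernel.Invariant T₀ ν₀)
    (hT₁ : Kernel.Invariant T₁ ν₁)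
    (hex : ∃ (ε : ℝ≥0∞) (ν : Measure (Bool × Ω)), IsProbabilityMeasure ν ∧ ε ≠ 0 ∧
      ∀ z, ε • ν ≤ nHit (switchKernel κF κR c W s e ∘ₖ levelKernel T₀ T₁) 2 z)
    {ΔF : ℝ} (hΔF : Real.exp (-ΔF) = ((ν₀ univ)⁻¹ * ν₁ univ).toReal) (z : Bool × Ω)
    (hY : haveI := isMarkovKernel_switchKernel (κF := κF) (κR := κR) (c := c)
              h.measurable_W h.measurable_s h.measurable_e
      HasLaw Y (gaussianReal 0 (Real.toNNReal
        (2 * Scoring.tauInt (setACF (switchKernel κF κR c W s e ∘ₖ levelKernel T₀ T₁)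
            ((jointWeight c ν₀ ν₁ univ)⁻¹ • jointWeight c ν₀ ν₁) (targetLevel Ω))
          * (Real.sigmoid (c - ΔF) * (1 - Real.sigmoid (c - ΔF)))))) P')
    [hP : haveI := isMarkovKernel_switchKernel (κF := κF) (κR := κR) (c := c)
              h.measurable_W h.measurable_s h.measurable_e
      haveI := isMarkovKernel_levelKernel T₀ T₁
      IsProbabilityMeasure (Kernel.trajMeasure (X := fun _ : ℕ => Bool × Ω) (Measure.dirac z)
        (fun n : ℕ => (switchKernel κF κR c W s e ∘ₖ levelKernel T₀ T₁).comap
          (fun hh : (j : ↥(Finset.Iic n)) → Bool × Ω => hh ⟨n, Finset.mem_Iic.2 le_rfl⟩)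
          (measurable_pi_apply _)))] :
    haveI := isMarkovKernel_switchKernel (κF := κF) (κR := κR) (c := c)
      h.measurable_W h.measurable_s h.measurable_e
    haveI := isMarkovKernel_levelKernel T₀ T₁
    TendstoInDistribution (fun (n : ℕ) (x : ℕ → Bool × Ω) =>
        Real.sqrt n * ((∑ i ∈ range n, (targetLevel Ω).indicator (1 : Bool × Ω → ℝ) (x i)) / n
          - Real.sigmoid (c - ΔF)))
      atTop Y (fun _ => Kernel.trajMeasure (X := fun _ : ℕ => Bool × Ω) (Measure.dirac z)
        (fun n : ℕ => (switchKernel κF κR c W s e ∘ₖ levelKernel T₀ T₁).comap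
          (fun hh : (j : ↥(Finset.Iic n)) → Bool × Ω => hh ⟨n, Finset.mem_Iic.2 le_rfl⟩)
          (measurable_pi_apply _))) P' := by
  obtain ⟨ε, ν, hν, hε, hD⟩ := hex
  haveI := hν
  exact h.ncmc_occupancy_clt_of_sq h0 h1 hT₀ hT₁ hε hD hΔF z hY

/-- **From an existential two-step certificate: the `dF_occ` CLT from every initial state.** -/
theorem CrooksPair.ncmc_dFocc_clt_of_exists_sq (h : CrooksPair ν₀ ν₁ κF κR s e W)
    (h0 : ν₀ univ ≠ 0) (h1 : ν₁ univ ≠ 0) (hT₀ : Kernel.Invariant T₀ ν₀)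
    (hT₁ : Kernel.Invariant T₁ ν₁)
    (hex : ∃ (ε : ℝ≥0∞) (ν : Measure (Bool × Ω)), IsProbabilityMeasure ν ∧ ε ≠ 0 ∧
      ∀ z, ε • ν ≤ nHit (switchKernel κF κR c W s e ∘ₖ levelKernel T₀ T₁) 2 z)
    {ΔF : ℝ} (hΔF : Real.exp (-ΔF) = ((ν₀ univ)⁻¹ * ν₁ univ).toReal) (z : Bool × Ω)
    (hY : haveI := isMarkovKernel_switchKernel (κF := κF) (κR := κR) (c := c)
              h.measurable_W h.measurable_s h.measurable_e
      HasLaw Y (gaussianReal 0 (Real.toNNReal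
        (2 * Scoring.tauInt (setACF (switchKernel κF κR c W s e ∘ₖ levelKernel T₀ T₁)
            ((jointWeight c ν₀ ν₁ univ)⁻¹ • jointWeight c ν₀ ν₁) (targetLevel Ω))
          / (Real.sigmoid (c - ΔF) * (1 - Real.sigmoid (c - ΔF)))))) P')
    [hP : haveI := isMarkovKernel_switchKernel (κF := κF) (κR := κR) (c := c)
              h.measurable_W h.measurable_s h.measurable_e
      haveI := isMarkovKernel_levelKernel T₀ T₁
      IsProbabilityMeasure (Kernel.trajMeasure (X := fun _ : ℕ => Bool × Ω) (Measure.dirac z)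
        (fun n : ℕ => (switchKernel κF κR c W s e ∘ₖ levelKernel T₀ T₁).comap
          (fun hh : (j : ↥(Finset.Iic n)) → Bool × Ω => hh ⟨n, Finset.mem_Iic.2 le_rfl⟩)
          (measurable_pi_apply _)))] :
    haveI := isMarkovKernel_switchKernel (κF := κF) (κR := κR) (c := c)
      h.measurable_W h.measurable_s h.measurable_e
    haveI := isMarkovKernel_levelKernel T₀ T₁
    TendstoInDistribution (fun (n : ℕ) (x : ℕ → Bool × Ω) =>
        Real.sqrt n * ((c - Real.log
            ((∑ i ∈ range n, (targetLevel Ω).indicator (1 : Bool × Ω → ℝ) (x i)) / n /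
              (1 - (∑ i ∈ range n, (targetLevel Ω).indicator (1 : Bool × Ω → ℝ) (x i)) / n)))
          - ΔF))
      atTop Y (fun _ => Kernel.trajMeasure (X := fun _ : ℕ => Bool × Ω) (Measure.dirac z)
        (fun n : ℕ => (switchKernel κF κR c W s e ∘ₖ levelKernel T₀ T₁).comap
          (fun hh : (j : ↥(Finset.Iic n)) → Bool × Ω => hh ⟨n, Finset.mem_Iic.2 le_rfl⟩)
          (measurable_pi_apply _))) P' := by
  obtain ⟨ε, ν, hν, hε, hD⟩ := hex
  haveI := hν
  exact h.ncmc_dFocc_clt_of_sq h0 h1 hT₀ hT₁ hε hD hΔF z hY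

end NCMC

end Summit.Ventures.LatticeQCDFlow.Exactness.GeneralNCMC
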